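import Mathlib
import Literature.Analysis.FluidPDE.BiotSavartHolder
import Literature.Analysis.FluidPDE.BiotSavartBounds
import Literature.Analysis.FluidPDE.AxisymmetricVorticityTransport
import Literature.Analysis.FluidPDE.ClassicalSolutionCalculus
import HarnessLib

/-!
# Slab bounds for classical confined-vortex members represented by Biot–Savart
# (crux `EulerZoomLiouville.PowerGaugeEulerLiouville` = stmt-NavierStokesRegularity-19832; line `vortex-volume` of ns-idea-11, stub V1b
# `stub_slabBounds` — filler)

Route `EulerZoomLiouville` (NavierStokesRegularity); width seat ns-ezl-w1 on the interim LEAD ns-typeII-p2 g10's assignment (2026-08-28T05:45:47Z,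
chain V2 → V1 → V1b → V3).  A CLASSICAL member whose vorticity slices are supported in the balls `B(0, κ(1+|τ|)^β)` and whose slices are
their Biot–Savart fields, `u(τ) = K₃ ∗ curl u(τ)`, has velocity AND velocity gradient bounded on every compact past time interval
`[s, t]`, `s < t < 0` — the hypothesis `hB` of the tree's vortex-volume conservation `VorticitySupport.volume_vorticitySupport_eq_of_classical`:

* on `[s,t]` all vorticity slices live in the one ball `B̄(0, R̄)`, `R̄ = κ(1+|s|)^β`; by joint smoothness, `curl u` and `∇ curl u` are bounded
  on the compact `[s,t] × B̄(0,R̄)` (and vanish outside), say by `M` and `D`;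
* velocity: Majda–Bertozzi Lemma 4.5, `‖K₃ ∗ ω‖ ≤ 5 M R̄` (tree `norm_biotSavart_le_of_support_subset`);
* gradient: Majda–Bertozzi Lemma 4.6 / (4.39) with Hölder exponent `γ = 1` (Lipschitz constant `D`), `‖∇(K₃ ∗ ω)‖ ≤ c (D R̄ + M)`
  (tree `exists_norm_fderiv_biotSavart_le`).

Main theorem `CompactVortex.slabBounds_of_biotSavart` = the line's `Sig.stub_slabBounds` with `InClass` (unused), `IsConfinedVortex`
(binders `κ, β`, the support inclusion; `β(1−ρ) < 1` unused) and `HasSlabBounds` unfolded — Theorems files do not import Cruxes.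
WHAT THIS IS NOT: not NS, not E, not V3 — one S/M stratum tool `--supports` stmt-19832. [cite: MajdaBertozziCUP2002, §4.1.3 Lemma 4.5–4.6]
-/

noncomputable section

-- flat `Theorems/<Route><Decl>…` files of one crux share the namespace of the crux (tree convention: `Summit.<S>.<S>.…`)
set_option linter.dupNamespace false

open MeasureTheory Set Filter Topology Metric Function TopologicalSpace
open scoped ENNReal NNReal ContDiff

namespace Summit.NavierStokesRegularity.NavierStokesRegularity.Theorems.PowerGaugeEulerLiouville

open Literature.Analysis Literature.Analysis.FunctionSpaces Literature.Analysis.FluidPDE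

namespace CompactVortex

/-- **SLAB BOUNDS FOR CLASSICAL CONFINED-VORTEX MEMBERS REPRESENTED BY BIOT–SAVART** (`Sig.stub_slabBounds` of the line `vortex-volume`,
unfolded): if `(u, p)` is a classical Euler solution on `(−∞, 0)`, the vorticity slices are confined, `supp curl u(τ) ⊆ B(0, κ(1+|τ|)^β)`
(`κ > 0`, `β ≥ 0`), and every slice is its Biot–Savart field, `u(τ) = K₃ ∗ curl u(τ)` (`τ < 0`), then for all `s < t < 0` there is `B` with
`‖u(τ, y)‖ ≤ B` and `‖∇u(τ)(y)‖ ≤ B` for all `τ ∈ [s,t]`, `y ∈ ℝ³`. [cite: MajdaBertozziCUP2002, §4.1.3 Lemma 4.5 (4.34), Lemma 4.6 (4.39)] -/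
theorem slabBounds_of_biotSavart
    {u : ℝ → EuclideanSpace ℝ (Fin 3) → EuclideanSpace ℝ (Fin 3)} {p : ℝ → EuclideanSpace ℝ (Fin 3) → ℝ}
    (hcl : IsClassicalEulerSolutionOn (Iio 0) 0 u p)
    {κ β : ℝ} (hκ : 0 < κ) (hβ : 0 ≤ β)
    (hsupp : ∀ τ : ℝ, τ < 0 → Function.support (curl (u τ)) ⊆ ball (0 : EuclideanSpace ℝ (Fin 3)) (κ * (1 + |τ|) ^ β))
    (hBS : ∀ τ : ℝ, τ < 0 → u τ = biotSavart (curl (u τ))) :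
    ∀ s t : ℝ, s < t → t < 0 → ∃ B : ℝ, ∀ τ ∈ Icc s t, ∀ y : EuclideanSpace ℝ (Fin 3),
      ‖u τ y‖ ≤ B ∧ ‖fderiv ℝ (u τ) y‖ ≤ B := by
  intro s t hst ht0
  -- ### the common support ball on `[s, t]`
  set Rb : ℝ := κ * (1 + |s|) ^ β with hRb
  have hRb0 : 0 < Rb := mul_pos hκ (Real.rpow_pos_of_pos (by positivity) _)
  have hτneg : ∀ τ ∈ Icc s t, τ < 0 := fun τ hτ => lt_of_le_of_lt hτ.2 ht0
  have hrad : ∀ τ ∈ Icc s t, κ * (1 + |τ|) ^ β ≤ Rb := by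
    intro τ hτ
    have h1 : |τ| ≤ |s| := by
      rw [abs_of_neg (hτneg τ hτ), abs_of_neg (lt_of_le_of_lt hτ.1 (hτneg τ hτ))]
      linarith [hτ.1]
    rw [hRb]
    exact mul_le_mul_of_nonneg_left (Real.rpow_le_rpow (by positivity) (by linarith) hβ) hκ.le
  have hsuppb : ∀ τ ∈ Icc s t, Function.support (curl (u τ)) ⊆ closedBall (0 : EuclideanSpace ℝ (Fin 3)) Rb :=
    fun τ hτ => ((hsupp τ (hτneg τ hτ)).trans (ball_subset_ball (hrad τ hτ))).trans ball_subset_closedBall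
  have htsuppb : ∀ τ ∈ Icc s t, tsupport (curl (u τ)) ⊆ closedBall (0 : EuclideanSpace ℝ (Fin 3)) Rb :=
    fun τ hτ => closure_minimal (hsuppb τ hτ) isClosed_closedBall
  -- ### joint smoothness of the vorticity and of its gradient
  have hS : UniqueDiffOn ℝ (Iio (0 : ℝ)) := uniqueDiffOn_Iio 0
  have hΩ : IsSmoothSpaceTimeOn (Iio (0 : ℝ)) (fun τ => curl (u τ)) :=
    hcl.smooth_velocity.isSmoothSpaceTimeOn_vorticity hS
  have hDΩ : IsSmoothSpaceTimeOn (Iio (0 : ℝ)) (fun τ y => fderiv ℝ (curl (u τ)) y) := hΩ.fderiv_slice hS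
  set Kc : Set (ℝ × EuclideanSpace ℝ (Fin 3)) := Icc s t ×ˢ closedBall (0 : EuclideanSpace ℝ (Fin 3)) Rb with hKc
  have hKc : IsCompact Kc := isCompact_Icc.prod (isCompact_closedBall _ _)
  have hKsub : Kc ⊆ Iio (0 : ℝ) ×ˢ (univ : Set (EuclideanSpace ℝ (Fin 3))) :=
    prod_mono (fun τ hτ => hτneg τ hτ) (subset_univ _)
  obtain ⟨M, hM⟩ := hKc.exists_bound_of_continuousOn (hΩ.continuousOn.mono hKsub)
  obtain ⟨D, hD⟩ := hKc.exists_bound_of_continuousOn (hDΩ.continuousOn.mono hKsub)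
  have hM0 : 0 ≤ max M 0 := le_max_right _ _
  have hD0 : 0 ≤ max D 0 := le_max_right _ _
  -- global bounds on each slice of `[s, t]` (the fields vanish off the ball)
  have hMall : ∀ τ ∈ Icc s t, ∀ y, ‖curl (u τ) y‖ ≤ max M 0 := by
    intro τ hτ y
    by_cases hy : y ∈ closedBall (0 : EuclideanSpace ℝ (Fin 3)) Rb
    · exact (hM (τ, y) (mk_mem_prod hτ hy)).trans (le_max_left _ _)
    · have : curl (u τ) y = 0 := by
        by_contra h
        exact hy (hsuppb τ hτ (Function.mem_support.2 h))
      rw [this, norm_zero]; exact hM0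
  have hDall : ∀ τ ∈ Icc s t, ∀ y, ‖fderiv ℝ (curl (u τ)) y‖ ≤ max D 0 := by
    intro τ hτ y
    by_cases hy : y ∈ closedBall (0 : EuclideanSpace ℝ (Fin 3)) Rb
    · exact (hD (τ, y) (mk_mem_prod hτ hy)).trans (le_max_left _ _)
    · have : fderiv ℝ (curl (u τ)) y = 0 := fderiv_of_notMem_tsupport ℝ (fun h => hy (htsuppb τ hτ h))
      rw [this, norm_zero]; exact hD0
  -- ### the two Biot–Savart bounds
  obtain ⟨c, hc0, hc⟩ := exists_norm_fderiv_biotSavart_le (γ := 1) one_pos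
  set D' : ℝ≥0 := ⟨max D 0, hD0⟩ with hD'
  refine ⟨max (5 * max M 0 * Rb) (c * ((D' : ℝ) * Rb ^ ((1 : ℝ≥0) : ℝ) + max M 0)), fun τ hτ y => ⟨?_, ?_⟩⟩
  · -- velocity: Lemma 4.5
    rw [hBS τ (hτneg τ hτ)]
    exact (norm_biotSavart_le_of_support_subset hRb0 (hMall τ hτ) (hsuppb τ hτ) y).trans (le_max_left _ _)
  · -- gradient: Lemma 4.6 with the Lipschitz (`γ = 1`) modulus of the vorticity slice
    have hωd : Differentiable ℝ (curl (u τ)) := by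
      have hv : ContDiff ℝ ∞ (u τ) := hcl.contDiff_velocity (hτneg τ hτ)
      have hω : ContDiff ℝ ∞ (curl (u τ)) := by
        rw [curl_eq_curlCLM_comp]
        exact curlCLM.contDiff.comp (hv.fderiv_right (m := ∞) (by simp))
      exact hω.differentiable (by simp)
    have hLip : LipschitzWith D' (curl (u τ)) :=
      lipschitzWith_of_nnnorm_fderiv_le hωd fun y => by
        rw [← NNReal.coe_le_coe, coe_nnnorm]
        exact hDall τ hτ y
    have hHol : HolderWith D' 1 (curl (u τ)) := holderWith_one.2 hLip
    rw [hBS τ (hτneg τ hτ)]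
    exact (hc (curl (u τ)) D' 0 Rb (max M 0) hRb0 hHol (htsuppb τ hτ) (hMall τ hτ) y).trans (le_max_right _ _)

end CompactVortex

end Summit.NavierStokesRegularity.NavierStokesRegularity.Theorems.PowerGaugeEulerLiouville
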